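import Mathlib
import Literature.NumberTheory.LFunctions.Zhang2022.TypedSection17
import Literature.NumberTheory.LFunctions.Zhang2022.Section8Eq81aResidue
import HarnessLib

/-!
# Zhang (2022) §17 (17.1), residue step: for `ψ ∈ Ψ₁`,
# `Σ_{ρ∈𝔷(ψ)} 𝔨*₃(ρ,ψ)ω(ρ) = (1/2πi)∫_{∂ℜ} 𝔨₃(s,ψ)ω(s) ds` on an admissible rectangle — kernel-checked

Topic `Literature/NumberTheory/LFunctions/Zhang2022` (Landau–Siegel audit tree; verdict-neutral).
Y. Zhang, *Discrete mean estimates and the Landau–Siegel zero*, arXiv:2211.02515v1 (2022)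
[Zhang2022LandauSiegel] — **an unrefereed manuscript under adjudication**; nothing here asserts or
denies its Theorems 1–2. DAG node `Z22:(17.1)` [Z22 p.95, tex L4698–L4706], first half:

> "Write `𝔨₃(s,ψ) = (L(s+β₁,ψ)/L(s,ψ))B(s,ψ)G(s,ψ)N(s+β₂,ψ)N(s+β₃,ψ)F(1−s,ψ̄)` and
> `I₄^±(ψ) = (1/2πi)∫_{𝔍(±α)} 𝔨₃(s,ψ)ω(s)ds`. Similar to the treatment of `Φ₂`,
> `Φ₃ = Σ_{ψ∈Ψ₁}(p_ψt₀)^{β₃}(I₄⁺(ψ) − I₄⁻(ψ)) + O(ε)`."  (17.1)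

The "similar treatment" is the residue theorem of (8.1) (§8 p.42, tex L2197–L2203: "By Proposition 2.2,
we can choose a rectangle `ℜ` with vertices at `s₀ ± α + i𝓛₁^{±}` … the set of zeros of `L(s,ψ)` inside
`ℜ` is exactly `𝔷(ψ)` … by the residue theorem …"). This file proves the §17 instance of that first
equality, at ONE character and ONE admissible rectangle (`Section8aStatements.AdmRect`, the typed
object of `Z22:§8.u003`), exactly as `Section8aStatements.eq81a_at` (file `Section8Eq81aResidue`,
sz L2 DISCHARGE #5) does for (8.1): the integrand `𝔨₃(s,ψ)ω(s) = G(s)/L(s,ψ)` has the ENTIRE numerator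
`G(s) = L(s+β₁,ψ)B(s,ψ)G(s,ψ)N(s+β₂,ψ)N(s+β₃,ψ)F(1−s,ψ̄)ω(s)` (`L(·,ψ)` is entire for the
non-principal `ψ`; `B, G, N, F` are finite Dirichlet polynomials over `n ≥ 1`; `ω` is a Gaussian), its
poles in a `c₀α/2`-collar of the closed rectangle are the zeros of `L(s,ψ)` there, i.e. exactly `𝔷(ψ)`
(admissibility), each simple by Proposition 2.2 (ii) (`L′(ρ,ψ) ≠ 0`,
`Skeleton.deriv_LFunction_ne_zero_of_deriv_LL_ne_zero`), with `𝔨₃ω = φ_ρ/(z − ρ)`,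
`φ_ρ = G/dslope L ρ`, `φ_ρ(ρ) = 𝔨*₃(ρ,ψ)ω(ρ)` (`𝔨*₃` = `Skeleton.kstar3`, (13.6)). The residue theorem is
the tree's `Literature.Analysis.Complex.rectBoundaryIntegral_eq_sum_of_simplePoles` (Conway V.2.2).

Main results: `eq17_1a_at` (one character, one admissible rectangle; hypotheses: `D ≥ 3`, `χ`
primitive, `0 < α`, `c₀ > 0`, `𝓛₁⁻ < 𝓛₁⁺`, Prop. 2.2 (ii) at `ψ`). Simpler than the (8.1) case: no
branch `Y(s,ψ)` of `Z(s,ψ)^{−1/2}` occurs, so no upper-half-plane condition is needed. No new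
definitions, no named facts; adapted from `Section8Eq81aResidue.lean` (sz L2-t?) with attribution.
ZHANG-L discharge lane (WP16, seat zl-w16-p7), leaf `Typed.Section17.Eq17_1` of
`Skeleton.theorem1_of_leaves_v19` — this file is the first of three (residue step, contour
remainder, assembly over `Ψ₁`). WHAT THIS IS NOT: a claim about Proposition 2.2, (17.1)'s truth in
isolation from it, Theorems 1–2 of the source, or Landau–Siegel zeros.

## References

* Y. Zhang, arXiv:2211.02515v1 (2022), §17 (17.1) p. 95 (tex L4698–L4706); §8 (8.1) p. 42
  (tex L2197–L2203); §13 (13.6), (13.10) p. 74. [cite: Zhang2022LandauSiegel, §17 (17.1) p. 95]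
* J. B. Conway, *Functions of One Complex Variable I*, 2nd ed. (1978), Ch. V Thm. 2.2 (residue
  theorem; the tree's `RectangleResidueSimplePoles`). [cite: Conway1978, Ch. V Thm. 2.2]
-/

noncomputable section

open Complex Real Set Filter Topology

namespace Literature.NumberTheory.LFunctions.Zhang2022.Typed.Section17

open Literature.NumberTheory.LFunctions.Zhang2022 Skeleton
open Literature.NumberTheory.LFunctions.Zhang2022.Section8aStatements
  (rectR onBoundaryR AdmRect rectIntegral differentiable_omegaW)
open Literature.Analysis.Complex (rectBoundaryIntegral rectBoundaryIntegral_eq_sum_of_simplePoles)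

/-! ## Holomorphy of the Dirichlet polynomials `B, G, N, F(·,ψ̄)` -/

section Holomorphy

variable {D : ℕ} (χ : DirichletCharacter ℂ D) (x : Chr D)

/-- `w ↦ n^{−w}` is entire for `n ≥ 1`. [folklore] -/
private theorem differentiable_natCast_cpow_neg {n : ℕ} (hn : n ≠ 0) :
    Differentiable ℂ (fun w : ℂ => (n : ℂ) ^ (-w)) :=
  differentiable_id.neg.const_cpow (Or.inl (Nat.cast_ne_zero.mpr hn))

/-- A finite Dirichlet polynomial `Σ_{n∈S} c(n)n^{−w}` over `n ≥ 1` is entire. [folklore] -/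
private theorem differentiable_dirichletSum {S : Finset ℕ} (hS : ∀ n ∈ S, n ≠ 0) (c : ℕ → ℂ) :
    Differentiable ℂ (fun w : ℂ => ∑ n ∈ S, c n * (n : ℂ) ^ (-w)) := by
  refine Differentiable.fun_sum fun n hn => ?_
  exact (differentiable_natCast_cpow_neg (hS n hn)).const_mul _

/-- Members of `Finset.Icc 1 N` are non-zero. [folklore] -/
private theorem ne_zero_of_mem_Icc {N n : ℕ} (h : n ∈ Finset.Icc 1 N) : n ≠ 0 :=
  Nat.one_le_iff_ne_zero.mp (Finset.mem_Icc.mp h).1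

/-- Members of `Finset.Ico 1 N` are non-zero. [folklore] -/
private theorem ne_zero_of_mem_Ico {N n : ℕ} (h : n ∈ Finset.Ico 1 N) : n ≠ 0 :=
  Nat.one_le_iff_ne_zero.mp (Finset.mem_Ico.mp h).1

/-- `G(s,ψ) = Σ_{n≤D⁴} υ(n)ψ(n)n^{−s}` (§3 p. 6) is entire. [cite: Zhang2022LandauSiegel, §3 p. 6] -/
theorem differentiable_Gpoly : Differentiable ℂ (Gpoly χ x) := by
  have h : Gpoly χ x = fun w => ∑ n ∈ Finset.Icc 1 (D ^ 4),
      (ups χ n * x.ψ (n : ZMod x.p)) * (n : ℂ) ^ (-w) := by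
    funext w; rw [Gpoly]
  rw [h]
  exact differentiable_dirichletSum (fun n hn => ne_zero_of_mem_Icc hn) _

/-- `F(s,ψ̄) = Σ_{n≤D⁴} ν(n)ψ̄(n)n^{−s}` (§4) is entire. [cite: Zhang2022LandauSiegel, §4 Lemma 4.4] -/
theorem differentiable_FpolyBar' : Differentiable ℂ (FpolyBar χ x) := by
  have h : FpolyBar χ x = fun w => ∑ n ∈ Finset.Icc 1 (D ^ 4),
      (nu χ n * starRingEnd ℂ (x.ψ (n : ZMod x.p))) * (n : ℂ) ^ (-w) := by
    funext w; rw [FpolyBar]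
  rw [h]
  exact differentiable_dirichletSum (fun n hn => ne_zero_of_mem_Icc hn) _

/-- `N(w,θ) = Σ_{n<2T²} θ(n)n^{−w}g*(T²/n)` (§6) is entire in `w`.
[cite: Zhang2022LandauSiegel, §6 Lemma 6.1] -/
theorem differentiable_Nchar (θ : ℕ → ℂ) : Differentiable ℂ (Nchar D θ) := by
  have h : Nchar D θ = fun w => ∑ n ∈ Finset.Ico 1 ⌈2 * bigT D ^ 2⌉₊,
      (θ n * (gstar D (bigT D ^ 2 / n) : ℂ)) * (n : ℂ) ^ (-w) := by
    funext w; rw [Nchar]; refine Finset.sum_congr rfl fun n _ => ?_; ring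
  rw [h]
  exact differentiable_dirichletSum (fun n hn => ne_zero_of_mem_Ico hn) _

/-- `H₁₂(s,ψ)` (2.24) is entire. [cite: Zhang2022LandauSiegel, §2 (2.24)] -/
theorem differentiable_H12 : Differentiable ℂ (H12 χ x) := by
  have h : H12 χ x = fun w => ∑ n ∈ Finset.Ico 1 ⌈Skeleton.P2 D⌉₊, (vk2 D n * pc χ x n) * (n : ℂ) ^ (-w) := by
    funext w; rw [H12]
  rw [h]
  exact differentiable_dirichletSum (fun n hn => ne_zero_of_mem_Ico hn) _

/-- `H₁₃(s,ψ)` (2.25) is entire. [cite: Zhang2022LandauSiegel, §2 (2.25)] -/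
theorem differentiable_H13 : Differentiable ℂ (H13 χ x) := by
  have h : H13 χ x = fun w => ∑ n ∈ Finset.Ico 1 ⌈Skeleton.P3 D⌉₊, (vk3 D n * pc χ x n) * (n : ℂ) ^ (-w) := by
    funext w; rw [H13]
  rw [h]
  exact differentiable_dirichletSum (fun n hn => ne_zero_of_mem_Ico hn) _

/-- `H₁₄(s,ψ)` (12.1) is entire. [cite: Zhang2022LandauSiegel, §12 (12.1)] -/
theorem differentiable_H14 : Differentiable ℂ (H14 χ x) := by
  have h : H14 χ x = fun w =>
      ∑ n ∈ (Finset.Ico 1 ⌈Skeleton.P1 D⌉₊).filter (fun n : ℕ => (n : ℝ) < bigP D ^ (1 / 2 : ℝ)),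
        (vk1 D n * pc χ x n) * (n : ℂ) ^ (-w) := by
    funext w; rw [H14]
  rw [h]
  exact differentiable_dirichletSum
    (fun n hn => ne_zero_of_mem_Ico (Finset.mem_filter.mp hn).1) _

/-- `H₂(s,ψ) = ῑ₃H₁₃ + ῑ₄H₁₂` (2.27) is entire. [cite: Zhang2022LandauSiegel, §2 (2.27)] -/
theorem differentiable_H2 : Differentiable ℂ (H2 χ x) := by
  have h : H2 χ x = fun w => starRingEnd ℂ iota3 * H13 χ x w + starRingEnd ℂ iota4 * H12 χ x w := by
    funext w; rw [H2]
  rw [h]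
  exact ((differentiable_H13 χ x).const_mul _).add ((differentiable_H12 χ x).const_mul _)

/-- `B(s,ψ) = (H₁₄ + ι₂H₁₂)H₂` (12.2) is entire. [cite: Zhang2022LandauSiegel, §12 (12.2)] -/
theorem differentiable_Bpoly : Differentiable ℂ (Bpoly χ x) := by
  have h : Bpoly χ x = fun w => (H14 χ x w + iota2 * H12 χ x w) * H2 χ x w := by
    funext w; rw [Bpoly]
  rw [h]
  exact ((differentiable_H14 χ x).add ((differentiable_H12 χ x).const_mul _)).mul
    (differentiable_H2 χ x)

/-- The numerator `G(s) = L(s+β₁,ψ)B(s,ψ)G(s,ψ)N(s+β₂,ψ)N(s+β₃,ψ)F(1−s,ψ̄)ω(s)` of `𝔨₃(s,ψ)ω(s)` is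
entire (`L(·,ψ)` entire for the non-principal `ψ`). [cite: Zhang2022LandauSiegel, §17 (17.1) p. 95] -/
theorem differentiable_numerator3 (c' : ℝ) :
    Differentiable ℂ (fun z => x.ψ.LFunction (z + beta1 c' D) * Bpoly χ x z * Gpoly χ x z *
      Nchar D (psiFn x) (z + beta2 c' D) * Nchar D (psiFn x) (z + beta3 c' D) *
      FpolyBar χ x (1 - z) * omegaW D z) := by
  have hL : Differentiable ℂ x.ψ.LFunction := DirichletCharacter.differentiable_LFunction x.ψ_ne_one
  have h1 : Differentiable ℂ (fun z => x.ψ.LFunction (z + beta1 c' D)) :=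
    hL.comp (differentiable_id.add_const _)
  have h2 : Differentiable ℂ (fun z => Nchar D (psiFn x) (z + beta2 c' D)) :=
    (differentiable_Nchar (psiFn x)).comp (differentiable_id.add_const _)
  have h3 : Differentiable ℂ (fun z => Nchar D (psiFn x) (z + beta3 c' D)) :=
    (differentiable_Nchar (psiFn x)).comp (differentiable_id.add_const _)
  have hF : Differentiable ℂ (fun z => FpolyBar χ x (1 - z)) :=
    (differentiable_FpolyBar' χ x).comp ((differentiable_const _).sub differentiable_id)
  exact (((((h1.mul (differentiable_Bpoly χ x)).mul (differentiable_Gpoly χ x)).mul h2).mul h3).mul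
    hF).mul (differentiable_omegaW D)

end Holomorphy

/-! ## The residue identity at one character and one admissible rectangle -/

section Setting

variable {D : ℕ} [NeZero D] (χ : DirichletCharacter ℂ D)

/-- Clamping `v` into `[lo, hi]`: the clamped value lies in `[lo, hi]`, is within `δ` of `v` when
`lo − δ < v < hi + δ`, and sits at the corresponding end when `v` is outside (verbatim from
`Section8Eq81aResidue`, private there). [folklore] -/
private theorem clamp_spec {lo hi v δ : ℝ} (hlh : lo ≤ hi) (hδ : 0 < δ) (h1 : lo - δ < v)
    (h2 : v < hi + δ) :
    lo ≤ max lo (min hi v) ∧ max lo (min hi v) ≤ hi ∧ |max lo (min hi v) - v| < δ ∧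
      (v ≤ lo → max lo (min hi v) = lo) ∧ (hi ≤ v → max lo (min hi v) = hi) := by
  refine ⟨le_max_left _ _, max_le hlh (min_le_left _ _), ?_, ?_, ?_⟩
  · rcases le_total hi v with h | h
    · rw [min_eq_left h, max_eq_right hlh, abs_lt]
      constructor <;> linarith
    · rw [min_eq_right h]
      rcases le_total lo v with h' | h'
      · rw [max_eq_right h', sub_self, abs_zero]; exact hδ
      · rw [max_eq_left h', abs_lt]
        constructor <;> linarith
  · intro hv
    rw [min_eq_right (le_trans hv hlh), max_eq_left hv]
  · intro hv
    rw [min_eq_left hv, max_eq_right hlh]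

/-- **(17.1), residue step, at one character and one admissible rectangle**: for `D ≥ 3`, `χ`
primitive, `0 < α`, `c₀ > 0`, `𝓛₁⁻ < 𝓛₁⁺`, a character `ψ` whose `Ω`-zeros of `L(s,ψ)L(s,ψχ)` are
simple (Prop. 2.2 (ii)), and an admissible rectangle `ℜ` (§8.u003):
`Σ_{ρ∈𝔷(ψ)} 𝔨*₃(ρ,ψ)ω(ρ) = (1/2πi)∮_{∂ℜ} 𝔨₃(s,ψ)ω(s) ds` — "similar to the treatment of `Φ₂`" /
"by the residue theorem" ((8.1)). [cite: Zhang2022LandauSiegel, §17 (17.1) p. 95, tex L4698–L4706] -/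
theorem eq17_1a_at (hD : 3 ≤ D) (hχ : χ.IsPrimitive) (c' : ℝ) (x : Chr D)
    {C c₀ Lm Lp : ℝ} (hc₀ : 0 < c₀) (hα : 0 < alpha D) (hLmLp : Lm < Lp)
    (h_ii : ∀ s ∈ prodZeroSetOmega χ x,
      deriv (fun w => x.ψ.LFunction w * (psiChi χ x).LFunction w) s ≠ 0)
    (hR : AdmRect D x C c₀ Lm Lp) :
    ∑ ρ ∈ finsetOf (zeroSet D x), kstar3 c' χ x ρ * omegaW D ρ =
      rectIntegral D Lm Lp (fun s => kfrak3 c' χ x s * omegaW D s) := by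
  obtain ⟨-, -, hzeros, hdist⟩ := hR
  set T : ℝ := 2 * π * t0 D with hT
  set δ : ℝ := c₀ * alpha D / 2 with hδ
  have hδ0 : 0 < δ := by positivity
  -- the integrand as `G/L`
  set F : ℂ → ℂ := fun s => kfrak3 c' χ x s * omegaW D s with hF_def
  set G : ℂ → ℂ := fun z => x.ψ.LFunction (z + beta1 c' D) * Bpoly χ x z * Gpoly χ x z *
      Nchar D (psiFn x) (z + beta2 c' D) * Nchar D (psiFn x) (z + beta3 c' D) *
      FpolyBar χ x (1 - z) * omegaW D z with hG_def
  have hFG : ∀ z, F z = G z / x.ψ.LFunction z := by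
    intro z
    simp only [hF_def, hG_def, kfrak3, div_eq_mul_inv]
    ring
  have hLdiff : Differentiable ℂ x.ψ.LFunction :=
    DirichletCharacter.differentiable_LFunction x.ψ_ne_one
  have hGdiff : Differentiable ℂ G := differentiable_numerator3 χ x c'
  -- the finite set of poles
  have hfin : (zeroSet D x).Finite := zerosFinite_holds D x
  set S : Finset ℂ := finsetOf (zeroSet D x) with hS_def
  have hmemS : ∀ z, z ∈ S ↔ z ∈ zeroSet D x := fun z => mem_finsetOf hfin
  have hzeroR : ∀ {z}, z ∈ zeroSet D x → z ∈ rectR D Lm Lp := fun {z} hz => by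
    have h : z ∈ {ρ | x.ψ.LFunction ρ = 0 ∧ ρ ∈ rectR D Lm Lp} := by rw [hzeros]; exact hz
    exact h.2
  -- the open collar `U` around the closed rectangle
  set U : Set ℂ := Ioo (1 / 2 - alpha D - δ) (1 / 2 + alpha D + δ) ×ℂ Ioo (T + Lm - δ) (T + Lp + δ)
    with hU_def
  have hUo : IsOpen U := isOpen_Ioo.reProdIm isOpen_Ioo
  have hKU : Icc (1 / 2 - alpha D) (1 / 2 + alpha D) ×ℂ Icc (T + Lm) (T + Lp) ⊆ U := by
    intro z hz
    rw [mem_reProdIm] at hz ⊢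
    exact ⟨⟨by linarith [hz.1.1], by linarith [hz.1.2]⟩, ⟨by linarith [hz.2.1], by linarith [hz.2.2]⟩⟩
  -- a zero of `L(s,ψ)` in the collar lies in `𝔷(ψ)` (else it is within `c₀α` of `∂ℜ`)
  have hLzero : ∀ z ∈ U, x.ψ.LFunction z = 0 → z ∈ zeroSet D x := by
    intro z hz hL
    by_cases hrect : z ∈ rectR D Lm Lp
    · have h : z ∈ {ρ | x.ψ.LFunction ρ = 0 ∧ ρ ∈ rectR D Lm Lp} := ⟨hL, hrect⟩
      rwa [hzeros] at h
    · exfalso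
      rw [mem_reProdIm] at hz
      obtain ⟨⟨hzr1, hzr2⟩, ⟨hzi1, hzi2⟩⟩ := hz
      obtain ⟨hr1, hr2, hr3, hr4, hr5⟩ :=
        clamp_spec (lo := 1 / 2 - alpha D) (hi := 1 / 2 + alpha D) (v := z.re) (by linarith) hδ0
          hzr1 hzr2
      obtain ⟨hi1, hi2, hi3, hi4, hi5⟩ :=
        clamp_spec (lo := T + Lm) (hi := T + Lp) (v := z.im) (by linarith) hδ0 hzi1 hzi2
      set s : ℂ := ⟨max (1 / 2 - alpha D) (min (1 / 2 + alpha D) z.re),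
        max (T + Lm) (min (T + Lp) z.im)⟩ with hs_def
      have hsre : s.re = max (1 / 2 - alpha D) (min (1 / 2 + alpha D) z.re) := rfl
      have hsim : s.im = max (T + Lm) (min (T + Lp) z.im) := rfl
      have hsB : s ∈ onBoundaryR D Lm Lp := by
        refine ⟨⟨?_, ?_, ?_⟩, fun hsR => hrect ?_⟩
        · rw [hsre, abs_le]; constructor <;> linarith
        · rw [hsim]; exact hi1
        · rw [hsim]; exact hi2
        · obtain ⟨h1, h2, h3⟩ := hsR
          rw [hsre] at h1
          rw [hsim] at h2 h3
          refine ⟨?_, ?_, ?_⟩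
          · by_contra hc
            rw [not_lt] at hc
            rcases le_abs'.mp hc with h | h
            · rw [hr4 (by linarith)] at h1
              rw [abs_lt] at h1
              linarith [h1.1]
            · rw [hr5 (by linarith)] at h1
              rw [abs_lt] at h1
              linarith [h1.2]
          · by_contra hc
            rw [not_lt] at hc
            rw [hi4 hc] at h2
            exact lt_irrefl _ h2
          · by_contra hc
            rw [not_lt] at hc
            rw [hi5 hc] at h3
            exact lt_irrefl _ h3
      have hfar := hdist s hsB z hL
      have hnear : ‖s - z‖ < c₀ * alpha D := by
        have h := Complex.norm_le_abs_re_add_abs_im (s - z)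
        rw [Complex.sub_re, Complex.sub_im, hsre, hsim] at h
        have : c₀ * alpha D = δ + δ := by rw [hδ]; ring
        linarith
      linarith
  -- `L ≠ 0` on `U ∖ S`, and the integrand is holomorphic there
  have hLne : ∀ z ∈ U, z ∉ zeroSet D x → x.ψ.LFunction z ≠ 0 := fun z hz hzS hL =>
    hzS (hLzero z hz hL)
  have hFdiff : DifferentiableOn ℂ F (U \ ↑S) := by
    intro z hz
    obtain ⟨hzU, hzS⟩ := hz
    have hzS' : z ∉ zeroSet D x := fun h => hzS (Finset.mem_coe.mpr ((hmemS z).mpr h))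
    have h := (hGdiff z).div (hLdiff z) (hLne z hzU hzS')
    have hFeq : F = fun z => G z / x.ψ.LFunction z := funext hFG
    rw [hFeq]
    exact h.differentiableWithinAt
  -- the poles are simple, with the printed residues
  have hpoles : ∀ p ∈ S, ∃ φ : ℂ → ℂ, ∃ V ∈ 𝓝 p, DifferentiableOn ℂ φ V ∧
      φ p = (fun q => kstar3 c' χ x q * omegaW D q) p ∧
      ∀ z ∈ V, z ≠ p → F z = φ z / (z - p) := by
    intro p hpS
    have hp : p ∈ zeroSet D x := (hmemS p).mp hpS
    have hpR : p ∈ rectR D Lm Lp := hzeroR hp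
    have hpU : p ∈ U := by
      obtain ⟨h1, h2, h3⟩ := hpR
      rw [mem_reProdIm]
      have h1' := abs_lt.mp h1
      exact ⟨⟨by linarith [h1'.1], by linarith [h1'.2]⟩, ⟨by linarith, by linarith⟩⟩
    have hL0 : x.ψ.LFunction p = 0 := hp.2.2
    have hpS' : p ∈ prodZeroSetOmega χ x := mem_prodZeroSetOmega_of_mem_zeroSet χ hp
    have hL1 : deriv x.ψ.LFunction p ≠ 0 :=
      deriv_LFunction_ne_zero_of_deriv_LL_ne_zero χ hD hχ x hL0 (h_ii p hpS')
    -- `g = dslope L p`, holomorphic on `U`, `g(p) = L′(p) ≠ 0`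
    set g : ℂ → ℂ := dslope x.ψ.LFunction p with hg_def
    have hgdiff : DifferentiableOn ℂ g U :=
      (Complex.differentiableOn_dslope (hUo.mem_nhds hpU)).mpr hLdiff.differentiableOn
    have hgp : g p = deriv x.ψ.LFunction p := dslope_same _ _
    have hgne : {z | g z ≠ 0} ∈ 𝓝 p := by
      have hc : ContinuousAt g p := (hgdiff.differentiableAt (hUo.mem_nhds hpU)).continuousAt
      exact hc.preimage_mem_nhds (isOpen_ne.mem_nhds (by rw [hgp]; exact hL1))
    set V : Set ℂ := U ∩ {z | g z ≠ 0} with hV_def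
    have hV : V ∈ 𝓝 p := inter_mem (hUo.mem_nhds hpU) hgne
    refine ⟨fun z => G z * (g z)⁻¹, V, hV, ?_, ?_, ?_⟩
    · intro z hz
      obtain ⟨hzU, hgz⟩ := hz
      have hgd : DifferentiableAt ℂ g z := hgdiff.differentiableAt (hUo.mem_nhds hzU)
      exact ((hGdiff z).mul (hgd.inv hgz)).differentiableWithinAt
    · simp only [hG_def, hgp, kstar3, div_eq_mul_inv]
      ring
    · intro z hz hzp
      have hgz : g z = x.ψ.LFunction z / (z - p) := by
        rw [hg_def, dslope_of_ne _ hzp, slope_def_field, hL0, sub_zero]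
      show F z = G z * (g z)⁻¹ / (z - p)
      rw [hFG z, hgz]
      have hzp' : z - p ≠ 0 := sub_ne_zero.mpr hzp
      by_cases hLz : x.ψ.LFunction z = 0
      · rw [hLz]; simp
      · field_simp
  -- the residue theorem
  have hab : (1 : ℝ) / 2 - alpha D < 1 / 2 + alpha D := by linarith
  have hcd : T + Lm < T + Lp := by linarith
  have hSsub : (↑S : Set ℂ) ⊆ Ioo (1 / 2 - alpha D) (1 / 2 + alpha D) ×ℂ Ioo (T + Lm) (T + Lp) := by
    intro p hp
    have hp' : p ∈ zeroSet D x := (hmemS p).mp (Finset.mem_coe.mp hp)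
    obtain ⟨h1, h2, h3⟩ := hzeroR hp'
    rw [mem_reProdIm]
    have h1' := abs_lt.mp h1
    exact ⟨⟨by linarith [h1'.1], by linarith [h1'.2]⟩, ⟨h2, h3⟩⟩
  have key := rectBoundaryIntegral_eq_sum_of_simplePoles hab hcd S F
    (fun q => kstar3 c' χ x q * omegaW D q) U hUo hKU hSsub hFdiff hpoles
  have h2πI : (2 * π * I : ℂ) ≠ 0 := by simp [Real.pi_ne_zero, I_ne_zero]
  rw [rectIntegral, ← hT, key, ← mul_assoc, one_div_mul_cancel h2πI, one_mul]

end Setting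

end Literature.NumberTheory.LFunctions.Zhang2022.Typed.Section17
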